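import Summits.Ventures.WeilGRH.KeyPolytope
import Literature.NumberTheory.LFunctions.WeilExplicitArchParitySech
import HarnessLib

/-!
# GRH arm (rh-explicit, venture WeilGRH): PARITY TRANSFER between keys — `E_{0,L,v,N} ≤ E_{1,L,v,N} ≤ E_{0,L+π,v,N}`

Cell `rh-explicit`, WEIL TRACK — GRH ARM, sequel of `KeyPolytope.lean` (key vocabulary: a key is
`(a, L, v)` = (parity, log-conductor, prime data on `n ≤ N`); `E_{a,L,v,N}(g) = (1/2π)∫|ĝ(½+iτ)|² M_{a,L,v,N}(τ)dτ`
with `M_{a,L,v,N}(τ) = Re ψ(¼ + a/2 + iτ/2) + (L − log π) − ρ_{v,N}(τ)`; window positivity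
`WeilPositivityOnKey a L v N`; for a character `χ` mod `q ≠ 1` the rung `WeilPositivityOnChar χ (log(N+1)/2)`
is `WeilPositivityOnKey (charParity χ) (log q) χ N`, `weilPositivityOnChar_iff_key`).

`KeyPolytope.lean` typed the two AFFINE directions of the key (the prime data `v`, convexly; the
log-conductor `L`, as an exact additive shift `E_{a,L'} = E_{a,L} + (L' − L)‖g‖₂²`).  This file types the
third coordinate, the PARITY `a ∈ {0, 1}`: by the tree's sech identity
`Re ψ(¾ + iτ/2) − Re ψ(¼ + iτ/2) = π sech(πτ)` (`WeilArchParity.re_digamma_par_one_sub_zero`, the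
reflection formula for `ψ`; Weil 1952 (10)–(11): `K_{1,0} − K_{1,1} = 1/(e^{x/2} + e^{−x/2})`),

  `M_{1,L,v,N}(τ) − M_{0,L,v,N}(τ) = π sech(πτ) ∈ (0, π]`      (`weilFinitePrimeWeightKey_one_sub_zero`),

hence for every test function `g` (Plancherel `(1/2π)∫|ĝ(½+iτ)|² dτ = ‖g‖₂²`):

  `E_{1,L,v,N}(g) = E_{0,L,v,N}(g) + ½∫|ĝ(½+iτ)|² sech(πτ) dτ`     (`weilFinitePrimeQuadraticKey_one_eq_zero_add`),
  `E_{0,L,v,N}(g) ≤ E_{1,L,v,N}(g) ≤ E_{0,L,v,N}(g) + π‖g‖₂² = E_{0,L+π,v,N}(g)`.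

Consequences (family statements, no certificate needed):
* `WeilPositivityOnKey.odd_of_even`: an EVEN key certified ⟹ the ODD key with the same `(L, v)` certified;
* `WeilPositivityOnKey.even_of_odd_add_pi`: an ODD key certified at `L` ⟹ the EVEN key certified at `L + π`
  (conductor `× e^π ≈ 23.14`);
* for characters, on ANY window `[-t, t]` (`weilQuadraticChar_re_odd_sub_even_mem_Icc`,
  `weilPositivityOnChar_odd_of_even`, `weilPositivityOnChar_even_of_odd`): if `χ₀` mod `q₀ ≠ 1` is even,
  `χ₁` mod `q₁ ≠ 1` is odd and `χ₁(n) = χ₀(n)` at the prime powers `n < e^{2t}`, then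
  `Re Q_{χ₁}(g) − Re Q_{χ₀}(g) − (log q₁ − log q₀)‖g‖₂² ∈ [0, π‖g‖₂²]` for every test `g` on the window, so
  the rung `t` passes from `χ₀` to `χ₁` when `q₀ ≤ q₁`, and from `χ₁` to `χ₀` when `e^π q₁ ≤ q₀`.
In the cell's words (GRH/STRUCTURE §16(f)): for every key `z` and window, the odd landscape sits above the
even one by at most `π` — taking infima over unit test functions of `E₀ ≤ E₁ ≤ E₀ + π‖g‖₂²` gives
`0 ≤ F(z; 1) − F(z; 0) ≤ π` for the window infima (the typed statements are the pointwise ones, for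
every test function `g`; the cell's finite sections use the same pointwise weight inequality).
Everything is PROVED; no named facts; RH/GRH-free.

## References
* A. Weil, *Sur les "formules explicites" de la théorie des nombres premiers*, Comm. Sém. Math. Univ. Lund,
  tome suppl. (1952): (10) p. 258, (11) pp. 261–262, `K_{1,f}` p. 262. [Weil1952FormulesExplicites]
* G. E. Andrews, R. Askey, R. Roy, *Special Functions*, CUP 1999, (1.2.15) (reflection formula for `ψ`).
  [AndrewsAskeyRoy1999]
-/

noncomputable section

open Complex Set MeasureTheory
open scoped Real ArithmeticFunction.vonMangoldt

namespace Summit.Ventures.WeilGRH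

open Literature.NumberTheory.LFunctions

variable {q : ℕ} {g : ℝ → ℂ}

/-! ## The weights of the two parities differ by `π sech(πτ)` -/

/-- **`M_{1,L,v,N}(τ) − M_{0,L,v,N}(τ) = π / cosh(πτ)`** (the prime ripple and the `L − log π` term cancel;
the digamma kernels differ by the sech identity). [cite: Weil1952FormulesExplicites, (10) p. 258 and (11) pp. 261–262 (K_{1,0} vs K_{1,1}); AndrewsAskeyRoy1999, (1.2.15)] -/
theorem weilFinitePrimeWeightKey_one_sub_zero (L : ℝ) (v : ℕ → ℂ) (N : ℕ) (τ : ℝ) :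
    weilFinitePrimeWeightKey 1 L v N τ - weilFinitePrimeWeightKey 0 L v N τ = π / Real.cosh (π * τ) := by
  unfold weilFinitePrimeWeightKey
  rw [← WeilArchParity.re_digamma_par_one_sub_zero τ]
  ring

/-- The parity increment is positive: `0 < π / cosh(πτ)`. [folklore] -/
theorem pi_div_cosh_pos (τ : ℝ) : 0 < π / Real.cosh (π * τ) :=
  div_pos Real.pi_pos (Real.cosh_pos _)

/-- … and at most `π`: `π / cosh(πτ) ≤ π` (`cosh ≥ 1`). [folklore] -/
theorem pi_div_cosh_le_pi (τ : ℝ) : π / Real.cosh (π * τ) ≤ π :=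
  div_le_self Real.pi_pos.le (Real.one_le_cosh _)

/-- Pointwise: `M_{0,L,v,N} ≤ M_{1,L,v,N}`. [folklore] -/
theorem weilFinitePrimeWeightKey_zero_le_one (L : ℝ) (v : ℕ → ℂ) (N : ℕ) (τ : ℝ) :
    weilFinitePrimeWeightKey 0 L v N τ ≤ weilFinitePrimeWeightKey 1 L v N τ := by
  have h := weilFinitePrimeWeightKey_one_sub_zero L v N τ
  have := pi_div_cosh_pos τ
  linarith

/-- Pointwise: `M_{1,L,v,N} ≤ M_{0,L+π,v,N}` (`π sech ≤ π` and `M_{0,L+π} = M_{0,L} + π`). [folklore] -/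
theorem weilFinitePrimeWeightKey_one_le_zero_add_pi (L : ℝ) (v : ℕ → ℂ) (N : ℕ) (τ : ℝ) :
    weilFinitePrimeWeightKey 1 L v N τ ≤ weilFinitePrimeWeightKey 0 (L + π) v N τ := by
  have h := weilFinitePrimeWeightKey_one_sub_zero L v N τ
  have h2 := weilFinitePrimeWeightKey_add_sub 0 L (L + π) v N τ
  have := pi_div_cosh_le_pi τ
  linarith

/-! ## The analytic forms: `E₁ = E₀ + ½∫|ĝ|² sech(πτ)` -/

/-- `τ ↦ |ĝ(½+iτ)|² · π/cosh(πτ)` is integrable (bounded weight). [folklore] -/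
theorem integrable_norm_sq_weilMellin_mul_pi_div_cosh (hg : IsWeilTest g) :
    Integrable fun τ : ℝ ↦ ‖weilMellin g (1 / 2 + τ * I)‖ ^ 2 * (π / Real.cosh (π * τ)) := by
  refine integrable_norm_sq_weilMellin_mul hg (by fun_prop) Real.pi_pos.le le_rfl (B := 0) fun t ↦ ?_
  rw [abs_of_pos (pi_div_cosh_pos t)]
  simpa using pi_div_cosh_le_pi t

/-- **`E_{1,L,v,N}(g) = E_{0,L,v,N}(g) + (1/2π)∫|ĝ(½+iτ)|² π/cosh(πτ) dτ`** (`= E₀ + ½∫|ĝ|² sech(πτ)`): the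
odd-parity form is the even-parity form plus the positive sech form of
`WeilExplicitArchParitySech.lean`. [cite: Weil1952FormulesExplicites, (10)–(11) pp. 258–262] -/
theorem weilFinitePrimeQuadraticKey_one_eq_zero_add (hg : IsWeilTest g) (L : ℝ) (v : ℕ → ℂ) (N : ℕ) :
    weilFinitePrimeQuadraticKey 1 L v N g =
      weilFinitePrimeQuadraticKey 0 L v N g +
        1 / (2 * π) * ∫ τ : ℝ, ‖weilMellin g (1 / 2 + τ * I)‖ ^ 2 * (π / Real.cosh (π * τ)) := by
  unfold weilFinitePrimeQuadraticKey
  have h0 := integrable_norm_sq_weilMellin_mul_weilFinitePrimeWeightKey hg 0 L v N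
  have hs := integrable_norm_sq_weilMellin_mul_pi_div_cosh hg
  have e : (fun τ : ℝ ↦ ‖weilMellin g (1 / 2 + τ * I)‖ ^ 2 * weilFinitePrimeWeightKey 1 L v N τ) =
      fun τ : ℝ ↦ ‖weilMellin g (1 / 2 + τ * I)‖ ^ 2 * weilFinitePrimeWeightKey 0 L v N τ +
        ‖weilMellin g (1 / 2 + τ * I)‖ ^ 2 * (π / Real.cosh (π * τ)) := by
    funext τ
    rw [← mul_add, ← weilFinitePrimeWeightKey_one_sub_zero L v N τ]
    ring
  rw [e, integral_add h0 hs, mul_add]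

/-- The sech form is non-negative. [folklore] -/
theorem sech_form_nonneg (g : ℝ → ℂ) :
    0 ≤ 1 / (2 * π) * ∫ τ : ℝ, ‖weilMellin g (1 / 2 + τ * I)‖ ^ 2 * (π / Real.cosh (π * τ)) := by
  have hπ := Real.pi_pos
  have : 0 ≤ ∫ τ : ℝ, ‖weilMellin g (1 / 2 + τ * I)‖ ^ 2 * (π / Real.cosh (π * τ)) :=
    integral_nonneg fun τ ↦ mul_nonneg (by positivity) (pi_div_cosh_pos τ).le
  positivity

/-- The sech form is at most `π‖g‖₂²` (`sech ≤ 1` and Plancherel `∫|ĝ(½+iτ)|² = 2π‖g‖₂²`). [folklore] -/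
theorem sech_form_le (hg : IsWeilTest g) :
    1 / (2 * π) * ∫ τ : ℝ, ‖weilMellin g (1 / 2 + τ * I)‖ ^ 2 * (π / Real.cosh (π * τ)) ≤
      π * weilNorm2Sq g := by
  have hπ := Real.pi_pos
  have hle : ∫ τ : ℝ, ‖weilMellin g (1 / 2 + τ * I)‖ ^ 2 * (π / Real.cosh (π * τ)) ≤
      ∫ τ : ℝ, ‖weilMellin g (1 / 2 + τ * I)‖ ^ 2 * π := by
    refine integral_mono (integrable_norm_sq_weilMellin_mul_pi_div_cosh hg)
      ((integrable_norm_sq_weilMellin_half_line hg).mul_const π) fun τ ↦ ?_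
    exact mul_le_mul_of_nonneg_left (pi_div_cosh_le_pi τ) (by positivity)
  rw [integral_mul_const, integral_norm_sq_weilMellin_half_line hg] at hle
  calc 1 / (2 * π) * ∫ τ : ℝ, ‖weilMellin g (1 / 2 + τ * I)‖ ^ 2 * (π / Real.cosh (π * τ))
      ≤ 1 / (2 * π) * (2 * π * weilNorm2Sq g * π) := by gcongr
    _ = π * weilNorm2Sq g := by field_simp

/-- **`E_{0,L,v,N}(g) ≤ E_{1,L,v,N}(g)`**: at the same log-conductor and prime data the odd-parity form
dominates the even one. [cite: Weil1952FormulesExplicites, (10)–(11) pp. 258–262 (K_{1,1} ≤ K_{1,0})] -/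
theorem weilFinitePrimeQuadraticKey_zero_le_one (hg : IsWeilTest g) (L : ℝ) (v : ℕ → ℂ) (N : ℕ) :
    weilFinitePrimeQuadraticKey 0 L v N g ≤ weilFinitePrimeQuadraticKey 1 L v N g := by
  rw [weilFinitePrimeQuadraticKey_one_eq_zero_add hg]
  have := sech_form_nonneg g
  linarith

/-- **`E_{1,L,v,N}(g) ≤ E_{0,L,v,N}(g) + π‖g‖₂² = E_{0,L+π,v,N}(g)`**: the parity gap is at most `π` in
log-conductor units. [cite: Weil1952FormulesExplicites, (10)–(11) pp. 258–262] -/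
theorem weilFinitePrimeQuadraticKey_one_le_zero_add_pi (hg : IsWeilTest g) (L : ℝ) (v : ℕ → ℂ) (N : ℕ) :
    weilFinitePrimeQuadraticKey 1 L v N g ≤ weilFinitePrimeQuadraticKey 0 (L + π) v N g := by
  rw [weilFinitePrimeQuadraticKey_one_eq_zero_add hg,
    weilFinitePrimeQuadraticKey_eq_add_norm hg 0 L (L + π) v N]
  have := sech_form_le hg
  have e : (L + π - L) * weilNorm2Sq g = π * weilNorm2Sq g := by ring
  linarith

/-- The two-sided bracket in one statement: `0 ≤ E₁(g) − E₀(g) ≤ π‖g‖₂²`. [cite: Weil1952FormulesExplicites, (10)–(11) pp. 258–262] -/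
theorem weilFinitePrimeQuadraticKey_one_sub_zero_mem_Icc (hg : IsWeilTest g) (L : ℝ) (v : ℕ → ℂ) (N : ℕ) :
    weilFinitePrimeQuadraticKey 1 L v N g - weilFinitePrimeQuadraticKey 0 L v N g ∈
      Icc (0 : ℝ) (π * weilNorm2Sq g) := by
  have h1 := weilFinitePrimeQuadraticKey_zero_le_one hg L v N
  have h2 := weilFinitePrimeQuadraticKey_one_le_zero_add_pi hg L v N
  rw [weilFinitePrimeQuadraticKey_eq_add_norm hg 0 L (L + π) v N] at h2
  constructor <;> nlinarith

/-! ## Parity transfer of window positivity -/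

/-- **ODD FROM EVEN.** If the even key `(0, L, v)` has window positivity on `n ≤ N`, so does the odd key
`(1, L, v)`. [folklore] -/
theorem WeilPositivityOnKey.odd_of_even {L : ℝ} {v : ℕ → ℂ} {N : ℕ} (h : WeilPositivityOnKey 0 L v N) :
    WeilPositivityOnKey 1 L v N :=
  fun g hg hsupp ↦ (h g hg hsupp).trans (weilFinitePrimeQuadraticKey_zero_le_one hg L v N)

/-- **EVEN FROM ODD, ONE `π` HIGHER.** If the odd key `(1, L, v)` has window positivity on `n ≤ N`, so does
the even key `(0, L + π, v)` (conductor multiplied by `e^π`). [folklore] -/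
theorem WeilPositivityOnKey.even_of_odd_add_pi {L : ℝ} {v : ℕ → ℂ} {N : ℕ}
    (h : WeilPositivityOnKey 1 L v N) : WeilPositivityOnKey 0 (L + π) v N :=
  fun g hg hsupp ↦ (h g hg hsupp).trans (weilFinitePrimeQuadraticKey_one_le_zero_add_pi hg L v N)

/-- Parity as a monotone coordinate: `a ≤ a'` (in `{0,1}`) transfers positivity upward at fixed `(L, v)`.
[folklore] -/
theorem WeilPositivityOnKey.mono_parity {a a' : ℕ} (ha : a ≤ a') (ha' : a' ≤ 1) {L : ℝ} {v : ℕ → ℂ}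
    {N : ℕ} (h : WeilPositivityOnKey a L v N) : WeilPositivityOnKey a' L v N := by
  interval_cases a' <;> interval_cases a
  · exact h
  · exact h.odd_of_even
  · exact h

/-! ## For characters, on an arbitrary window `[-t, t]` -/

variable {q₀ q₁ : ℕ}

/-- The visible prime powers of the window `[-t, t]` are the `n ≤ N := ⌈e^{2t}⌉ − 1`, and
`e^{2t} ≤ N + 1`. [folklore] -/
private theorem window_index (t : ℝ) :
    Real.exp (2 * t) ≤ ((⌈Real.exp (2 * t)⌉₊ - 1 : ℕ) : ℝ) + 1 ∧
      ∀ n : ℕ, n ≤ ⌈Real.exp (2 * t)⌉₊ - 1 → (n : ℝ) < Real.exp (2 * t) := by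
  have hx : 0 < Real.exp (2 * t) := Real.exp_pos _
  have h1 : 1 ≤ ⌈Real.exp (2 * t)⌉₊ := Nat.one_le_iff_ne_zero.2 (Nat.pos_iff_ne_zero.1 (Nat.ceil_pos.2 hx))
  have hc : (((⌈Real.exp (2 * t)⌉₊ - 1 : ℕ) : ℝ)) = (⌈Real.exp (2 * t)⌉₊ : ℝ) - 1 := by
    rw [Nat.cast_sub h1, Nat.cast_one]
  refine ⟨?_, fun n hn ↦ ?_⟩
  · rw [hc, sub_add_cancel]; exact Nat.le_ceil _
  · have h2 := Nat.ceil_lt_add_one hx.le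
    have h3 : (n : ℝ) ≤ (⌈Real.exp (2 * t)⌉₊ : ℝ) - 1 := by rw [← hc]; exact_mod_cast hn
    linarith

/-- **On any window, an odd and an even character with the same visible values differ by the
log-conductor shift plus the sech form**: for `χ₀` mod `q₀ ≠ 1` even, `χ₁` mod `q₁ ≠ 1` odd with
`χ₁(n) = χ₀(n)` at the prime powers `n < e^{2t}`, and `g` a test function supported in `[-t, t]`,
`Re Q_{χ₁}(g) − Re Q_{χ₀}(g) − (log q₁ − log q₀)‖g‖₂² ∈ [0, π‖g‖₂²]`.
[cite: Weil1952FormulesExplicites, (10)–(11) pp. 258–262 (K_{1,0} − K_{1,1} = 1/(e^{x/2} + e^{−x/2}))] -/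
theorem weilQuadraticChar_re_odd_sub_even_mem_Icc (hq₀ : q₀ ≠ 1) (hq₁ : q₁ ≠ 1) [NeZero q₁]
    (χ₀ : DirichletCharacter ℂ q₀) (χ₁ : DirichletCharacter ℂ q₁) (h₀ : χ₀.Even) (h₁ : χ₁.Odd)
    {t : ℝ} (hv : ∀ n : ℕ, (n : ℝ) < Real.exp (2 * t) → Λ n ≠ 0 → χ₀ (n : ZMod q₀) = χ₁ (n : ZMod q₁))
    (hg : IsWeilTest g) (hsupp : tsupport g ⊆ Icc (-t) t) :
    (weilQuadraticChar χ₁ g).re - (weilQuadraticChar χ₀ g).re -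
        (Real.log q₁ - Real.log q₀) * weilNorm2Sq g ∈ Icc (0 : ℝ) (π * weilNorm2Sq g) := by
  obtain ⟨hN, hlt⟩ := window_index t
  set N : ℕ := ⌈Real.exp (2 * t)⌉₊ - 1
  have hvN : ∀ n ≤ N, Λ n ≠ 0 → χ₀ (n : ZMod q₀) = χ₁ (n : ZMod q₁) :=
    fun n hn hΛ ↦ hv n (hlt n hn) hΛ
  rw [weilQuadraticChar_re_eq_weilFinitePrimeQuadraticChar hq₁ χ₁ hg hN hsupp,
    weilQuadraticChar_re_eq_weilFinitePrimeQuadraticChar hq₀ χ₀ hg hN hsupp,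
    weilFinitePrimeQuadraticChar_eq_key, weilFinitePrimeQuadraticChar_eq_key, charParity_of_odd h₁,
    charParity_of_even h₀, weilFinitePrimeQuadraticKey_congr hvN 0 (Real.log q₀) g,
    weilFinitePrimeQuadraticKey_eq_add_norm hg 0 (Real.log q₁) (Real.log q₀) _ N]
  have h := weilFinitePrimeQuadraticKey_one_sub_zero_mem_Icc hg (Real.log q₁) (fun n ↦ χ₁ (n : ZMod q₁)) N
  simp only [mem_Icc] at h ⊢
  constructor <;> linarith [h.1, h.2]

/-- **An odd character inherits every rung of an even character with the same visible values and no
larger conductor.**  `χ₀` mod `q₀ ≠ 1` even, `χ₁` mod `q₁` odd, `χ₁(n) = χ₀(n)` at the prime powers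
`n < e^{2t}`, `q₀ ≤ q₁`: `WeilPositivityOnChar χ₀ t → WeilPositivityOnChar χ₁ t`. [folklore] -/
theorem weilPositivityOnChar_odd_of_even (hq₀ : q₀ ≠ 1) (hq₁ : q₁ ≠ 1) [NeZero q₁]
    (χ₀ : DirichletCharacter ℂ q₀) (χ₁ : DirichletCharacter ℂ q₁) (h₀ : χ₀.Even) (h₁ : χ₁.Odd) {t : ℝ}
    (hv : ∀ n : ℕ, (n : ℝ) < Real.exp (2 * t) → Λ n ≠ 0 → χ₀ (n : ZMod q₀) = χ₁ (n : ZMod q₁))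
    (hq : q₀ ≤ q₁) (h : WeilPositivityOnChar χ₀ t) : WeilPositivityOnChar χ₁ t := by
  intro g hg hsupp
  have hL : Real.log q₀ ≤ Real.log q₁ := by
    rcases Nat.eq_zero_or_pos q₀ with hz | hz
    · rw [hz, Nat.cast_zero, Real.log_zero]; exact Real.log_natCast_nonneg q₁
    · exact Real.log_le_log (by exact_mod_cast hz) (by exact_mod_cast hq)
  have h0 := h g hg hsupp
  have hI := weilQuadraticChar_re_odd_sub_even_mem_Icc hq₀ hq₁ χ₀ χ₁ h₀ h₁ hv hg hsupp
  have hn := weilNorm2Sq_nonneg g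
  nlinarith [hI.1]

/-- **An even character inherits every rung of an odd character with the same visible values and
conductor at least `e^π` times larger.**  `χ₁` mod `q₁ ≠ 1` odd, `χ₀` mod `q₀ ≠ 1` even, same values at
the prime powers `n < e^{2t}`, `log q₁ + π ≤ log q₀`: `WeilPositivityOnChar χ₁ t → WeilPositivityOnChar χ₀ t`.
[folklore] -/
theorem weilPositivityOnChar_even_of_odd (hq₀ : q₀ ≠ 1) (hq₁ : q₁ ≠ 1) [NeZero q₁]
    (χ₀ : DirichletCharacter ℂ q₀) (χ₁ : DirichletCharacter ℂ q₁) (h₀ : χ₀.Even) (h₁ : χ₁.Odd) {t : ℝ}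
    (hv : ∀ n : ℕ, (n : ℝ) < Real.exp (2 * t) → Λ n ≠ 0 → χ₀ (n : ZMod q₀) = χ₁ (n : ZMod q₁))
    (hq : Real.log q₁ + π ≤ Real.log q₀) (h : WeilPositivityOnChar χ₁ t) :
    WeilPositivityOnChar χ₀ t := by
  intro g hg hsupp
  have h1 := h g hg hsupp
  have hI := weilQuadraticChar_re_odd_sub_even_mem_Icc hq₀ hq₁ χ₀ χ₁ h₀ h₁ hv hg hsupp
  have hn := weilNorm2Sq_nonneg g
  nlinarith [hI.2]

end Summit.Ventures.WeilGRH
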